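import Literature.AlgebraicGeometry.Motives.WeilJacobianUniversal
import Literature.AlgebraicGeometry.HodgeTheory.CurveHodgeGenusBound
import Literature.AlgebraicGeometry.Motives.VarietiesProperProofs
import HarnessLib

/-!
# `dim J = g(C)` for every Jacobian of a smooth projective complex curve, in all genera (Milne, *Jacobian Varieties*, Prop. 2.1)

Topic `Literature/AlgebraicGeometry/Motives`, namespace `Literature.AlgebraicGeometry.Motives.Jacobian`;
THEOREMS ONLY (no definition, no named fact, no instance, sorry-free).

The tree proves `dim 𝒥 ≤ g(C)` over `ℂ` by Hodge theory (★ `HodgeTheory.Jacobian.dim_le_curveGenus`) and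
`g(C) ≤ dim 𝒥` over any algebraically closed field of characteristic `0` by Weil's construction
(★ `curveGenus_le_jacobian_dim`, where the genus-`0` case is trivial); the equality for genus `≥ 1` over
`K = K̄`, `char K = 0`, is ★ `Jacobian.dim_eq_curveGenus` (`WeilJacobianUniversal`, hypothesis
`0 < curveGenus C`). This file records the COMPLEX case in ALL genera — the `-- TODO(general form): genus 0`
of `WeilJacobianUniversal` as far as the dimension statement over `ℂ` goes — in the currency
`IsSmoothProjective 1 C` used by the named facts (`two_mul_dim_eq_finrank_bettiCohomology`,
`Milne1986_abelJacobi_isClosedImmersion`, …), so that the recurring two-line `le_antisymm` at consumers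
(★ `JacobianBrillNoetherLocusSymmetric`, `JacobianStepOneOpenTransport`, `JacobianAbelTheoremOfWeilModelHolds`,
`JacobianAbelJacobiInjective`) has a name:

* **`Jacobian.dim_eq_curveGenus_of_isSmoothProjective`** — `𝒥.J.dim = curveGenus C` for every Jacobian
  `𝒥` of a smooth projective complex curve `C` (Milne Prop. 2.1, all genera);
* `Jacobian.one_le_dim_iff_one_le_curveGenus_of_isSmoothProjective`, `Jacobian.dim_eq_zero_iff_…` — the
  genus thresholds in the two currencies agree;
* `Jacobian.dim_eq_of_isSmoothProjective` — two Jacobians of `C` have the same dimension (also ★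
  `Jacobian.dim_eq_dim` by the universal property; here as a by-product).

Cell `hodgecm-mathlib` (D-0151), count-neutral capital. HC_CM is proved only modulo the 7 printed citations
until rung 0 closes; this file discharges none of them.

## References

* J. S. Milne, *Jacobian Varieties*, in *Arithmetic Geometry* (Storrs 1984), Springer 1986, §2 Prop. 2.1
  (`dim J = g`). [Milne1986JacobianVarieties]
-/

set_option autoImplicit false

noncomputable section

universe u

open CategoryTheory AlgebraicGeometry
open Literature.NumberTheory.DiophantineGeometry

namespace Literature.AlgebraicGeometry.Motives

open CurvePlaces

namespace Jacobian

/-- **Milne, *Jacobian Varieties*, Prop. 2.1 over `ℂ`, all genera: `dim J = g(C)`** for every Jacobian `𝒥`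
(universal property of `Motives/Jacobian`) of a smooth projective complex curve `C` — `dim J ≤ g` by Hodge
theory (★ `HodgeTheory.Jacobian.dim_le_curveGenus`), `g ≤ dim J` by Weil's construction
(★ `curveGenus_le_jacobian_dim`). [cite: Milne1986JacobianVarieties, §2 Prop. 2.1] -/
theorem dim_eq_curveGenus_of_isSmoothProjective {C : SchemeOver ℂ} [IsIntegral C.left] (hC : IsSmoothProjective 1 C)
    (𝒥 : Jacobian C) : 𝒥.J.dim = curveGenus C := by
  haveI : SmoothOfRelativeDimension 1 C.hom := hC.smoothOfRelativeDimension
  haveI : IsProper C.hom := IsSmoothProjective.isProper_holds hC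
  exact le_antisymm (Literature.AlgebraicGeometry.HodgeTheory.Jacobian.dim_le_curveGenus (C := C) hC 𝒥)
    (curveGenus_le_jacobian_dim C hC.isProjectiveOver 𝒥)

/-- `1 ≤ dim J ↔ 1 ≤ g(C)` for a smooth projective complex curve (the genus threshold of the named facts
`Milne1986_abelJacobi_isClosedImmersion` ∕ `riemann_brillNoetherLocus_isPrincipalPolarizationDivisor` in the
function-field currency). [cite: Milne1986JacobianVarieties, §2 Prop. 2.1] -/
theorem one_le_dim_iff_one_le_curveGenus_of_isSmoothProjective {C : SchemeOver ℂ} [IsIntegral C.left]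
    (hC : IsSmoothProjective 1 C) (𝒥 : Jacobian C) : 1 ≤ 𝒥.J.dim ↔ 1 ≤ curveGenus C := by
  rw [dim_eq_curveGenus_of_isSmoothProjective hC 𝒥]

/-- `dim J = 0 ↔ g(C) = 0` for a smooth projective complex curve (genus-`0` curves have trivial
Jacobians). [cite: Milne1986JacobianVarieties, §2 Prop. 2.1] -/
theorem dim_eq_zero_iff_curveGenus_eq_zero_of_isSmoothProjective {C : SchemeOver ℂ} [IsIntegral C.left]
    (hC : IsSmoothProjective 1 C) (𝒥 : Jacobian C) : 𝒥.J.dim = 0 ↔ curveGenus C = 0 := by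
  rw [dim_eq_curveGenus_of_isSmoothProjective hC 𝒥]

/-- Two Jacobians of the same smooth projective complex curve have the same dimension (both equal
`g(C)`). [cite: Milne1986JacobianVarieties, §2 Prop. 2.1] -/
theorem dim_eq_of_isSmoothProjective {C : SchemeOver ℂ} (hC : IsSmoothProjective 1 C) (𝒥₁ 𝒥₂ : Jacobian C) :
    𝒥₁.J.dim = 𝒥₂.J.dim := by
  haveI : IsIntegral C.left := IsSmoothProjective.isIntegral_holds hC
  rw [dim_eq_curveGenus_of_isSmoothProjective hC 𝒥₁, dim_eq_curveGenus_of_isSmoothProjective hC 𝒥₂]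

end Jacobian

end Literature.AlgebraicGeometry.Motives

end
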